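import Literature.NumberTheory.Sieve.PolymathLcmSums
import Mathlib.NumberTheory.ArithmeticFunction.Moebius
import Mathlib.Data.Nat.Squarefree
import Mathlib.Data.Nat.GCD.Prime
import Mathlib.Analysis.SpecialFunctions.Pow.Complex
import Mathlib.Data.Fintype.BigOperators
import Mathlib.Tactic
import HarnessLib

/-!
# Polymath 8b, Lemma 4.1: the Euler product factorisation (euler-fac) via prime colourings

Trunk: AntSieve / parity.S13.  Part of the proof (fifth layer of the decomposition of the named fact
`Literature.NumberTheory.Sieve.frequently_nth_prime_succ_le_add_polymath`, `H₁ ≤ 246`) of the key asymptotic Lemma 4.1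
of D. H. J. Polymath, *Variants of the Selberg sieve, and bounded intervals containing many primes*,
Res. Math. Sci. 1:12 (2014) = arXiv:1407.4897 (the named fact `Literature.NumberTheory.Sieve.moebiusLcmSums_asymptotic` of
`PolymathLcmSums.lean`).  In the proof (p. 12) the Fourier-expanded sum

  `K = ∑_{d_1,…,d_k,d'_1,…,d'_k : [d_j,d'_j] pairwise coprime (and coprime to W)} ∏_j μ(d_j)μ(d'_j) / ([d_j,d'_j] d_j^{s_j} d'_j^{s'_j})`

"factorizes as an Euler product `K = ∏_p K_p`" ((euler-fac)).  This file proves that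
factorisation in the generality in which it is used: for weights `g_j, h_j : ℕ → ℂ` that are
multiplicative over products of distinct primes (`IsPrimeProdMult`; e.g. `μ(d) d^{-s}`, `d^{-σ}`) and a
finite set of primes `P`,

  `∑_{(d,d') : d_j, d'_j ∣ ∏P, [d_j,d'_j] pairwise coprime} ∏_j g_j(d_j) h_j(d'_j)/[d_j,d'_j]
     = ∏_{p ∈ P} (1 + (1/p) ∑_j (g_j(p)h_j(p) + g_j(p) + h_j(p)))`

(`LcmEuler.sum_pairBox_filter_eq_prod`).  The proof is the bijection between admissible pairs
`(d, d')` supported on `P` and colourings `P → Option (ι × Fin 3)` of the primes (a prime is unused,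
or divides exactly one `[d_j,d'_j]`, and then `d_j` and `d'_j`, only `d_j`, or only `d'_j`):
`colourFst/colourSnd` (pair of a colouring), `colourOf` (colouring of a pair), `colour_injective`,
`colourFst_colourOf`; and the multiplicativity `pairSummand_colour` (the summand of a colouring is the
product over the primes of the local weights `colourWeight`).  Everything here is elementary and
proved (Mathlib, plus `PolymathLcmSums.lean` for the bridge to `LcmCoprime`).

## References

* D. H. J. Polymath, *Variants of the Selberg sieve, and bounded intervals containing many primes*,
  Res. Math. Sci. 1 (2014), Art. 12; arXiv:1407.4897, proof of Lemma 4.1, (euler-fac), p. 12.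
  [Polymath8b2014]
-/

noncomputable section

open Finset
open scoped BigOperators

namespace Literature.NumberTheory.Sieve

namespace LcmEuler

variable {ι : Type*} [DecidableEq ι]

/-! ### Multiplicativity over products of distinct primes -/

/-- `g(∏_{q ∈ S} q) = ∏_{q ∈ S} g(q)` for every finite set `S` of primes (with `S = ∅`: `g 1 = 1`):
the multiplicativity used to factor the sum (multisum) into an Euler product ("This latter expression
factorizes as an Euler product `K = ∏_p K_p`", Polymath 8b p. 12).  This is exactly the conclusion of
Mathlib's `ArithmeticFunction.IsMultiplicative.map_prod_of_prime`: every multiplicative arithmetic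
function has it (`IsPrimeProdMult.of_isMultiplicative`); it is stated for bare functions `ℕ → ℂ`
because the weights of Lemma 4.1 are the products `d ↦ μ(d) d^{-s}` and `d ↦ d^{-σ}`, `1/d`, `1/φ(d)`
(see `PolymathLcmSumsEuler.lean`), and only this property is used. [cite: Polymath8b2014, Lemma 4.1 (proof)] -/
def IsPrimeProdMult (g : ℕ → ℂ) : Prop :=
  ∀ S : Finset ℕ, (∀ q ∈ S, q.Prime) → g (∏ q ∈ S, q) = ∏ q ∈ S, g q

/-- Multiplicative arithmetic functions are `IsPrimeProdMult` (Mathlib's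
`ArithmeticFunction.IsMultiplicative.map_prod_of_prime`). [folklore] -/
theorem IsPrimeProdMult.of_isMultiplicative {f : ArithmeticFunction ℂ} (hf : f.IsMultiplicative) :
    IsPrimeProdMult f := fun S hS => hf.map_prod_of_prime S hS

/-- A divisor of a product of distinct primes is the product of those primes dividing it. [folklore] -/
theorem eq_prod_filter_of_dvd_prod_primes (P : Finset ℕ) (hP : ∀ q ∈ P, q.Prime) {n : ℕ}
    (hn : n ∣ ∏ q ∈ P, q) : n = ∏ q ∈ P.filter (· ∣ n), q := by
  classical
  induction P using Finset.induction_on generalizing n with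
  | empty =>
    simp only [Finset.prod_empty, Nat.dvd_one] at hn
    subst hn; simp
  | insert p P hp ih =>
    have hpP : p.Prime := hP p (Finset.mem_insert_self p P)
    have hP' : ∀ q ∈ P, q.Prime := fun q hq => hP q (Finset.mem_insert_of_mem hq)
    rw [Finset.prod_insert hp] at hn
    by_cases hpn : p ∣ n
    · obtain ⟨m, rfl⟩ := hpn
      have hm : m ∣ ∏ q ∈ P, q := Nat.dvd_of_mul_dvd_mul_left hpP.pos hn
      have hpm : ¬ p ∣ m := by
        intro hpm'
        have h2 : p ∣ ∏ q ∈ P, q := hpm'.trans hm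
        obtain ⟨q, hq, hpq⟩ := (Nat.Prime.prime hpP).dvd_finsetProd_iff _ |>.1 h2
        have : p = q := (Nat.prime_dvd_prime_iff_eq hpP (hP' q hq)).1 hpq
        exact hp (this ▸ hq)
      have ihm := ih hP' hm
      have hfilter : (insert p P).filter (· ∣ p * m) = insert p (P.filter (· ∣ m)) := by
        ext q
        simp only [Finset.mem_filter, Finset.mem_insert]
        constructor
        · rintro ⟨hq | hq, hdvd⟩
          · exact Or.inl hq
          · right
            refine ⟨hq, ?_⟩
            have hqp : Nat.Coprime q p := (Nat.coprime_primes (hP' q hq) hpP).2 (fun h => hp (h ▸ hq))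
            exact hqp.dvd_of_dvd_mul_left hdvd
        · rintro (rfl | ⟨hq, hdvd⟩)
          · exact ⟨Or.inl rfl, dvd_mul_right _ _⟩
          · exact ⟨Or.inr hq, hdvd.mul_left _⟩
      rw [hfilter, Finset.prod_insert (fun h => hp (Finset.mem_filter.1 h).1), ← ihm]
    · have hcop : Nat.Coprime p n := (Nat.Prime.coprime_iff_not_dvd hpP).2 hpn
      have hn' : n ∣ ∏ q ∈ P, q := hcop.symm.dvd_of_dvd_mul_left hn
      have ihn := ih hP' hn'
      have hfilter : (insert p P).filter (· ∣ n) = P.filter (· ∣ n) := by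
        rw [Finset.filter_insert, if_neg hpn]
      rw [hfilter]
      exact ihn

/-! ### Colourings of a finite set of primes -/

/-- Colours of a prime in a term of (multisum): `none` (the prime divides no `d_j, d'_j`),
`some (j, 0)` (it divides `d_j` and `d'_j`), `some (j, 1)` (only `d_j`), `some (j, 2)` (only `d'_j`);
by the coprimality condition of (multisum) each prime receives exactly one colour.
[cite: Polymath8b2014, Lemma 4.1 (proof, (euler-fac))] -/
abbrev Colour (ι : Type*) := Option (ι × Fin 3)

variable (P : Finset ℕ)

/-- The product of the primes of colour `o`. [folklore] -/
def colourPart (c : ↥P → Colour ι) (o : Colour ι) : ℕ :=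
  ∏ q ∈ Finset.univ.filter (fun q : ↥P => c q = o), (q : ℕ)

/-- `d_j` of the colouring: primes coloured `(j,0)` or `(j,1)`. [folklore] -/
def colourFst (c : ↥P → Colour ι) (j : ι) : ℕ :=
  colourPart P c (some (j, 0)) * colourPart P c (some (j, 1))

/-- `d'_j` of the colouring: primes coloured `(j,0)` or `(j,2)`. [folklore] -/
def colourSnd (c : ↥P → Colour ι) (j : ι) : ℕ :=
  colourPart P c (some (j, 0)) * colourPart P c (some (j, 2))

variable {P}
variable (hP : ∀ q ∈ P, q.Prime)
include hP

/-- Elements of `P` are prime (under the standing hypothesis). [folklore] -/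
theorem prime_coe (q : ↥P) : (q : ℕ).Prime := hP q q.2

/-- Colour parts are positive. [folklore] -/
theorem colourPart_pos (c : ↥P → Colour ι) (o : Colour ι) : 0 < colourPart P c o :=
  Finset.prod_pos fun q _ => (prime_coe hP q).pos

/-- `d_j > 0`. [folklore] -/
theorem colourFst_pos (c : ↥P → Colour ι) (j : ι) : 0 < colourFst P c j :=
  Nat.mul_pos (colourPart_pos hP c _) (colourPart_pos hP c _)

/-- `d'_j > 0`. [folklore] -/
theorem colourSnd_pos (c : ↥P → Colour ι) (j : ι) : 0 < colourSnd P c j :=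
  Nat.mul_pos (colourPart_pos hP c _) (colourPart_pos hP c _)

/-- A prime `q ∈ P` divides the `o`-part iff its colour is `o`. [folklore] -/
theorem dvd_colourPart_iff (c : ↥P → Colour ι) (o : Colour ι) (q : ↥P) :
    (q : ℕ) ∣ colourPart P c o ↔ c q = o := by
  constructor
  · intro h
    obtain ⟨q', hq', hdvd⟩ := ((Nat.Prime.prime (prime_coe hP q)).dvd_finsetProd_iff _).1 h
    have heq : (q : ℕ) = q' := (Nat.prime_dvd_prime_iff_eq (prime_coe hP q) (prime_coe hP q')).1 hdvd
    have : q = q' := Subtype.ext heq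
    rw [this]
    exact (Finset.mem_filter.1 hq').2
  · intro h
    exact Finset.dvd_prod_of_mem (fun q : ↥P => (q : ℕ)) (Finset.mem_filter.2 ⟨Finset.mem_univ _, h⟩)

/-- Parts of different colours are coprime. [folklore] -/
theorem coprime_colourPart (c : ↥P → Colour ι) {o o' : Colour ι} (h : o ≠ o') :
    Nat.Coprime (colourPart P c o) (colourPart P c o') := by
  refine Nat.Coprime.prod_left fun q hq => Nat.Coprime.prod_right fun q' hq' => ?_
  have hne : (q : ℕ) ≠ q' := by
    intro heq
    have : q = q' := Subtype.ext heq
    rw [this] at hq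
    exact h ((Finset.mem_filter.1 hq).2.symm.trans (Finset.mem_filter.1 hq').2)
  exact (Nat.coprime_primes (prime_coe hP q) (prime_coe hP q')).2 hne

/-- `q ∣ d_j` iff the colour of `q` is `(j,0)` or `(j,1)`. [folklore] -/
theorem dvd_colourFst_iff (c : ↥P → Colour ι) (j : ι) (q : ↥P) :
    (q : ℕ) ∣ colourFst P c j ↔ c q = some (j, 0) ∨ c q = some (j, 1) := by
  rw [colourFst, (prime_coe hP q).dvd_mul, dvd_colourPart_iff hP, dvd_colourPart_iff hP]

/-- `q ∣ d'_j` iff the colour of `q` is `(j,0)` or `(j,2)`. [folklore] -/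
theorem dvd_colourSnd_iff (c : ↥P → Colour ι) (j : ι) (q : ↥P) :
    (q : ℕ) ∣ colourSnd P c j ↔ c q = some (j, 0) ∨ c q = some (j, 2) := by
  rw [colourSnd, (prime_coe hP q).dvd_mul, dvd_colourPart_iff hP, dvd_colourPart_iff hP]

/-- `[d_j, d'_j]` of a colouring is the product of its three `j`-parts. [folklore] -/
theorem lcm_colourFst_colourSnd (c : ↥P → Colour ι) (j : ι) :
    Nat.lcm (colourFst P c j) (colourSnd P c j) =
      colourPart P c (some (j, 0)) * colourPart P c (some (j, 1)) * colourPart P c (some (j, 2)) := by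
  rw [colourFst, colourSnd, Nat.lcm_mul_left, Nat.Coprime.lcm_eq_mul, mul_assoc]
  exact coprime_colourPart hP c (by simp)

/-- The `[d_j,d'_j]` of a colouring are pairwise coprime. [folklore] -/
theorem coprime_lcm_of_ne (c : ↥P → Colour ι) {i j : ι} (hij : i ≠ j) :
    Nat.Coprime (Nat.lcm (colourFst P c i) (colourSnd P c i))
      (Nat.lcm (colourFst P c j) (colourSnd P c j)) := by
  rw [lcm_colourFst_colourSnd hP, lcm_colourFst_colourSnd hP, mul_assoc, mul_assoc]
  have h : ∀ a b : Fin 3, Nat.Coprime (colourPart P c (some (i, a))) (colourPart P c (some (j, b))) :=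
    fun a b => coprime_colourPart hP c (by simp [hij])
  exact ((h 0 0).mul_right ((h 0 1).mul_right (h 0 2))).mul_left
    (((h 1 0).mul_right ((h 1 1).mul_right (h 1 2))).mul_left
      ((h 2 0).mul_right ((h 2 1).mul_right (h 2 2))))

omit hP in
/-- A colour part divides `∏ P`. [folklore] -/
theorem colourPart_dvd_prod (c : ↥P → Colour ι) (o : Colour ι) :
    colourPart P c o ∣ ∏ q ∈ P, q := by
  rw [colourPart, ← Finset.prod_coe_sort P]
  exact Finset.prod_dvd_prod_of_subset _ _ _ (Finset.filter_subset _ _)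

/-- `d_j ∣ ∏ P`. [folklore] -/
theorem colourFst_dvd_prod (c : ↥P → Colour ι) (j : ι) : colourFst P c j ∣ ∏ q ∈ P, q := by
  have h := (coprime_colourPart hP c (show (some (j, 0) : Colour ι) ≠ some (j, 1) by simp))
  exact h.mul_dvd_of_dvd_of_dvd (colourPart_dvd_prod c _) (colourPart_dvd_prod c _)

/-- `d'_j ∣ ∏ P`. [folklore] -/
theorem colourSnd_dvd_prod (c : ↥P → Colour ι) (j : ι) : colourSnd P c j ∣ ∏ q ∈ P, q := by
  have h := (coprime_colourPart hP c (show (some (j, 0) : Colour ι) ≠ some (j, 2) by simp))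
  exact h.mul_dvd_of_dvd_of_dvd (colourPart_dvd_prod c _) (colourPart_dvd_prod c _)

/-- A colouring is determined by its pair `(d, d')`. [folklore] -/
theorem colour_injective {c₁ c₂ : ↥P → Colour ι} (h1 : colourFst P c₁ = colourFst P c₂)
    (h2 : colourSnd P c₁ = colourSnd P c₂) : c₁ = c₂ := by
  funext q
  have hF : ∀ j, (c₁ q = some (j, 0) ∨ c₁ q = some (j, 1)) ↔ (c₂ q = some (j, 0) ∨ c₂ q = some (j, 1)) :=
    fun j => by rw [← dvd_colourFst_iff hP, ← dvd_colourFst_iff hP, h1]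
  have hS : ∀ j, (c₁ q = some (j, 0) ∨ c₁ q = some (j, 2)) ↔ (c₂ q = some (j, 0) ∨ c₂ q = some (j, 2)) :=
    fun j => by rw [← dvd_colourSnd_iff hP, ← dvd_colourSnd_iff hP, h2]
  rcases h : c₁ q with _ | ⟨j, t⟩
  · -- `none`
    rcases h' : c₂ q with _ | ⟨j, t⟩
    · rfl
    · exfalso
      have hF' := hF j; have hS' := hS j
      rw [h, h'] at hF' hS'
      fin_cases t <;> simp at hF' hS'
  · have hF' := hF j; have hS' := hS j
    rw [h] at hF' hS'
    fin_cases t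
    · -- (j,0): c₂ q ∈ {(j,0),(j,1)} ∩ {(j,0),(j,2)}
      simp only [Fin.zero_eta, Fin.isValue, true_or, true_iff] at hF' hS'
      rcases hF' with hF' | hF' <;> rcases hS' with hS' | hS'
      · exact hF'.symm
      · exact hF'.symm
      · exact hS'.symm
      · rw [hF'] at hS'; simp at hS'
    · simp only [Fin.mk_one, Fin.isValue, or_true, true_iff] at hF'
      have hS'' : ¬ (c₂ q = some (j, 0) ∨ c₂ q = some (j, 2)) := by
        rw [← hS']; simp
      rcases hF' with hF' | hF'
      · exact absurd (Or.inl hF') hS''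
      · exact hF'.symm
    · simp only [Fin.reduceFinMk, Fin.isValue, or_true, true_iff] at hS'
      have hF'' : ¬ (c₂ q = some (j, 0) ∨ c₂ q = some (j, 1)) := by
        rw [← hF']; simp
      rcases hS' with hS' | hS'
      · exact absurd (Or.inl hS') hF''
      · exact hS'.symm

omit hP in
/-- Products over a filter of `↥P` versus over a filter of `P`. [folklore] -/
theorem prod_univ_filter_coe (p : ℕ → Prop) [DecidablePred p] (f : ℕ → ℂ) :
    ∏ q ∈ Finset.univ.filter (fun q : ↥P => p q), f q = ∏ q ∈ P.filter p, f q := by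
  rw [Finset.prod_filter, Finset.prod_filter, Finset.prod_coe_sort P (fun q => if p q then f q else 1)]

omit hP in
/-- The same for `ℕ`-valued products. [folklore] -/
theorem prod_univ_filter_coe_nat (p : ℕ → Prop) [DecidablePred p] :
    ∏ q ∈ Finset.univ.filter (fun q : ↥P => p q), (q : ℕ) = ∏ q ∈ P.filter p, q := by
  rw [Finset.prod_filter, Finset.prod_filter, Finset.prod_coe_sort P (fun q => if p q then q else 1)]

section Surj

variable [Fintype ι]

/-- The colouring attached to an admissible pair `(d, d')` (inverse of `(colourFst, colourSnd)`). [folklore] -/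
def colourOf (t : (ι → ℕ) × (ι → ℕ)) (q : ↥P) : Colour ι :=
  if h : ∃ j, (q : ℕ) ∣ Nat.lcm (t.1 j) (t.2 j) then
    some (h.choose, if (q : ℕ) ∣ t.1 h.choose then (if (q : ℕ) ∣ t.2 h.choose then 0 else 1) else 2)
  else none

variable {t : (ι → ℕ) × (ι → ℕ)}
  (hpw : ∀ i j, i ≠ j → Nat.Coprime (Nat.lcm (t.1 i) (t.2 i)) (Nat.lcm (t.1 j) (t.2 j)))
include hpw

omit [Fintype ι] in
/-- A prime divides at most one of the `[d_j, d'_j]`. [folklore] -/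
theorem eq_of_dvd_lcm {q : ↥P} {i j : ι} (hi : (q : ℕ) ∣ Nat.lcm (t.1 i) (t.2 i))
    (hj : (q : ℕ) ∣ Nat.lcm (t.1 j) (t.2 j)) : i = j := by
  by_contra hne
  have h1 : (q : ℕ) ∣ Nat.gcd (Nat.lcm (t.1 i) (t.2 i)) (Nat.lcm (t.1 j) (t.2 j)) := Nat.dvd_gcd hi hj
  rw [Nat.Coprime.gcd_eq_one (hpw i j hne)] at h1
  exact (prime_coe hP q).one_lt.ne' (Nat.dvd_one.1 h1)

/-- The colouring of a pair recovers divisibility of `d_j`. [folklore] -/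
theorem colourOf_fst_iff (q : ↥P) (j : ι) :
    (colourOf (P := P) t q = some (j, 0) ∨ colourOf (P := P) t q = some (j, 1)) ↔ (q : ℕ) ∣ t.1 j := by
  unfold colourOf
  constructor
  · intro h
    by_cases hex : ∃ j, (q : ℕ) ∣ Nat.lcm (t.1 j) (t.2 j)
    · rw [dif_pos hex] at h
      simp only [Option.some.injEq, Prod.mk.injEq] at h
      have hj : hex.choose = j := by rcases h with h | h <;> exact h.1
      rw [← hj]
      by_contra hnd
      rw [if_neg hnd] at h
      rcases h with ⟨_, h⟩ | ⟨_, h⟩ <;> simp at h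
    · rw [dif_neg hex] at h; simp at h
  · intro hdvd
    have hex : ∃ j, (q : ℕ) ∣ Nat.lcm (t.1 j) (t.2 j) := ⟨j, hdvd.trans (Nat.dvd_lcm_left _ _)⟩
    rw [dif_pos hex]
    have hj : hex.choose = j :=
      eq_of_dvd_lcm hP hpw hex.choose_spec (hdvd.trans (Nat.dvd_lcm_left _ _))
    simp only [Option.some.injEq, Prod.mk.injEq, hj, true_and, if_pos hdvd]
    by_cases h2 : (q : ℕ) ∣ t.2 j
    · left; rw [if_pos h2]
    · right; rw [if_neg h2]

/-- The colouring of a pair recovers divisibility of `d'_j`. [folklore] -/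
theorem colourOf_snd_iff (q : ↥P) (j : ι) :
    (colourOf (P := P) t q = some (j, 0) ∨ colourOf (P := P) t q = some (j, 2)) ↔ (q : ℕ) ∣ t.2 j := by
  unfold colourOf
  constructor
  · intro h
    by_cases hex : ∃ j, (q : ℕ) ∣ Nat.lcm (t.1 j) (t.2 j)
    · rw [dif_pos hex] at h
      simp only [Option.some.injEq, Prod.mk.injEq] at h
      have hj : hex.choose = j := by rcases h with h | h <;> exact h.1
      have hspec := hex.choose_spec
      rw [hj] at hspec
      rw [← hj] at h ⊢
      rw [hj] at h ⊢
      by_cases h1 : (q : ℕ) ∣ t.1 j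
      · rw [if_pos h1] at h
        by_contra h2
        rw [if_neg h2] at h
        rcases h with ⟨_, h⟩ | ⟨_, h⟩ <;> simp at h
      · exact ((prime_coe hP q).dvd_lcm.1 hspec).resolve_left h1
    · rw [dif_neg hex] at h; simp at h
  · intro hdvd
    have hex : ∃ j, (q : ℕ) ∣ Nat.lcm (t.1 j) (t.2 j) := ⟨j, hdvd.trans (Nat.dvd_lcm_right _ _)⟩
    rw [dif_pos hex]
    have hj : hex.choose = j :=
      eq_of_dvd_lcm hP hpw hex.choose_spec (hdvd.trans (Nat.dvd_lcm_right _ _))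
    simp only [Option.some.injEq, Prod.mk.injEq, hj, true_and, if_pos hdvd]
    by_cases h1 : (q : ℕ) ∣ t.1 j
    · left; rw [if_pos h1]
    · right; rw [if_neg h1]

/-- Surjectivity of `(colourFst, colourSnd)` onto admissible pairs supported on `P`. [folklore] -/
theorem colourFst_colourOf (hd : ∀ j, t.1 j ∣ ∏ q ∈ P, q) (j : ι) :
    colourFst P (colourOf (P := P) t) j = t.1 j := by
  rw [colourFst, colourPart, colourPart, ← Finset.prod_union]
  · rw [← Finset.filter_or]
    have hcongr : Finset.univ.filter (fun q : ↥P => colourOf (P := P) t q = some (j, 0) ∨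
        colourOf (P := P) t q = some (j, 1)) = Finset.univ.filter (fun q : ↥P => (q : ℕ) ∣ t.1 j) :=
      Finset.filter_congr fun q _ => colourOf_fst_iff hP hpw q j
    rw [hcongr, prod_univ_filter_coe_nat (P := P) (p := (· ∣ t.1 j)),
      ← eq_prod_filter_of_dvd_prod_primes P hP (hd j)]
  · rw [Finset.disjoint_filter]
    intro q _ h1 h2
    rw [h1] at h2; simp at h2

/-- Surjectivity of `(colourFst, colourSnd)`, second component. [folklore] -/
theorem colourSnd_colourOf (hd : ∀ j, t.2 j ∣ ∏ q ∈ P, q) (j : ι) :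
    colourSnd P (colourOf (P := P) t) j = t.2 j := by
  rw [colourSnd, colourPart, colourPart, ← Finset.prod_union]
  · rw [← Finset.filter_or]
    have hcongr : Finset.univ.filter (fun q : ↥P => colourOf (P := P) t q = some (j, 0) ∨
        colourOf (P := P) t q = some (j, 2)) = Finset.univ.filter (fun q : ↥P => (q : ℕ) ∣ t.2 j) :=
      Finset.filter_congr fun q _ => colourOf_snd_iff hP hpw q j
    rw [hcongr, prod_univ_filter_coe_nat (P := P) (p := (· ∣ t.2 j)),
      ← eq_prod_filter_of_dvd_prod_primes P hP (hd j)]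
  · rw [Finset.disjoint_filter]
    intro q _ h1 h2
    rw [h1] at h2; simp at h2

end Surj

/-! ### The Euler product identity -/

section Euler

variable [Fintype ι]

/-- The local weight of a colour at the prime `q`: `1` (unused), `g_j(q)h_j(q)/q`, `g_j(q)/q`,
`h_j(q)/q`. [cite: Polymath8b2014, Lemma 4.1 (proof, (euler-fac))] -/
def colourWeight (g h : ι → ℕ → ℂ) (q : ℕ) : Colour ι → ℂ
  | none => 1
  | some (j, t) => if t = 0 then g j q * h j q / q else if t = 1 then g j q / q else h j q / q

/-- The summand `∏_j g_j(d_j) h_j(d'_j) / [d_j, d'_j]` of a multiplicative instance of (multisum).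
[cite: Polymath8b2014, Lemma 4.1 (proof)] -/
def pairSummand (g h : ι → ℕ → ℂ) (t : (ι → ℕ) × (ι → ℕ)) : ℂ :=
  ∏ j, g j (t.1 j) * h j (t.2 j) / (Nat.lcm (t.1 j) (t.2 j) : ℂ)

/-- Pairs `(d, d')` of tuples all of whose entries divide `∏_{q ∈ P} q` (i.e. are squarefree and
supported on the primes of `P`). [folklore] -/
def pairBox (ι : Type*) [Fintype ι] [DecidableEq ι] (P : Finset ℕ) : Finset ((ι → ℕ) × (ι → ℕ)) :=
  (Fintype.piFinset fun _ : ι => (∏ q ∈ P, q).divisors) ×ˢ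
    (Fintype.piFinset fun _ : ι => (∏ q ∈ P, q).divisors)

/-- The coprimality condition "`[d_1,d'_1], …, [d_k,d'_k]` coprime" of (multisum) and (euler-fac), on a
pair `t = (d, d')`.  This is, definitionally, the first conjunct of the summation condition
`Literature.LcmCoprime W d d'` of `PolymathLcmSums.lean` (the condition the named fact
`moebiusLcmSums_asymptotic` is stated with), which adds coprimality with `W`: see `lcmCoprime_iff` and
`pairwiseCoprimeLcm_iff_lcmCoprime_one` below; on pairs supported on primes not dividing `W` the two
agree (`LcmEuler.lcmCoprime_iff_of_mem_pairBox`, `PolymathLcmSumsEuler.lean`), which is how the Euler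
product of this file is applied to `lcmSum`. [cite: Polymath8b2014, Lemma 4.1] -/
def PairwiseCoprimeLcm (t : (ι → ℕ) × (ι → ℕ)) : Prop :=
  ∀ i j, i ≠ j → Nat.Coprime (Nat.lcm (t.1 i) (t.2 i)) (Nat.lcm (t.1 j) (t.2 j))

/-- Decidability of the coprimality condition. [folklore] -/
instance (t : (ι → ℕ) × (ι → ℕ)) : Decidable (PairwiseCoprimeLcm t) := by
  unfold PairwiseCoprimeLcm; infer_instance

omit [DecidableEq ι] [Fintype ι] hP in
/-- `LcmCoprime W d d'` is `PairwiseCoprimeLcm (d, d')` together with coprimality of the `[d_j,d'_j]`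
with `W` (definitional bridge to `PolymathLcmSums.lean`). [folklore] -/
theorem lcmCoprime_iff (W : ℕ) (d d' : ι → ℕ) :
    LcmCoprime W d d' ↔ PairwiseCoprimeLcm (d, d') ∧ ∀ j, Nat.Coprime (Nat.lcm (d j) (d' j)) W :=
  Iff.rfl

omit [DecidableEq ι] [Fintype ι] hP in
/-- `PairwiseCoprimeLcm t ↔ LcmCoprime 1 t.1 t.2`. [folklore] -/
theorem pairwiseCoprimeLcm_iff_lcmCoprime_one (t : (ι → ℕ) × (ι → ℕ)) :
    PairwiseCoprimeLcm t ↔ LcmCoprime 1 t.1 t.2 :=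
  ⟨fun h => ⟨h, fun _ => Nat.coprime_one_right _⟩, fun h => h.1⟩

/-- Multiplicativity over a set of primes of `P` given as a finset of `↥P`. [folklore] -/
theorem IsPrimeProdMult.map_prod_coe {g : ℕ → ℂ} (hg : IsPrimeProdMult g) (F : Finset ↥P) :
    g (∏ q ∈ F, (q : ℕ)) = ∏ q ∈ F, g q := by
  have h1 : (∏ q ∈ F, (q : ℕ)) = ∏ n ∈ F.map (Function.Embedding.subtype _), n := by
    rw [Finset.prod_map]; rfl
  have h2 : (∏ q ∈ F, g q) = ∏ n ∈ F.map (Function.Embedding.subtype _), g n := by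
    rw [Finset.prod_map]; rfl
  rw [h1, h2]
  exact hg _ fun n hn => by
    obtain ⟨q, _, rfl⟩ := Finset.mem_map.1 hn
    exact prime_coe hP q

omit [DecidableEq ι] [Fintype ι] hP in
/-- The `none`-fibre contributes `1`. [folklore] -/
theorem prod_filter_none (g h : ι → ℕ → ℂ) (c : ↥P → Colour ι) :
    ∏ q ∈ Finset.univ.filter (fun q : ↥P => c q = none), colourWeight g h q (c q) = 1 :=
  Finset.prod_eq_one fun q hq => by rw [(Finset.mem_filter.1 hq).2]; rfl

/-- **The summand of a colouring is the product of the local weights of its colours**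
(multiplicativity: `g_j(AB) = g_j(A) g_j(B)`, `[AB, AC] = ABC` for the pairwise coprime parts
`A, B, C` of index `j`). [cite: Polymath8b2014, Lemma 4.1 (proof, (euler-fac))] -/
theorem pairSummand_colour (g h : ι → ℕ → ℂ) (hg : ∀ j, IsPrimeProdMult (g j))
    (hh : ∀ j, IsPrimeProdMult (h j)) (c : ↥P → Colour ι) :
    pairSummand g h (colourFst P c, colourSnd P c) = ∏ q : ↥P, colourWeight g h q (c q) := by
  set Fb : ι → Fin 3 → Finset ↥P := fun j t => Finset.univ.filter (fun q : ↥P => c q = some (j, t))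
    with hFb
  have hpart : ∀ j t, colourPart P c (some (j, t)) = ∏ q ∈ Fb j t, (q : ℕ) := fun j t => rfl
  have hdisj : ∀ j (a b : Fin 3), a ≠ b → Disjoint (Fb j a) (Fb j b) := by
    intro j a b hab
    rw [hFb, Finset.disjoint_filter]
    intro q _ h1 h2
    rw [h1] at h2
    simp only [Option.some.injEq, Prod.mk.injEq, true_and] at h2
    exact hab h2
  have hne : ∀ F : Finset ↥P, (∏ q ∈ F, (q : ℂ)) ≠ 0 := fun F =>
    Finset.prod_ne_zero_iff.2 fun q _ => by exact_mod_cast (prime_coe hP q).ne_zero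
  -- per index
  have hj : ∀ j, g j (colourFst P c j) * h j (colourSnd P c j) /
      (Nat.lcm (colourFst P c j) (colourSnd P c j) : ℂ) =
      (∏ q ∈ Fb j 0, colourWeight g h q (c q)) * (∏ q ∈ Fb j 1, colourWeight g h q (c q)) *
        ∏ q ∈ Fb j 2, colourWeight g h q (c q) := by
    intro j
    have hw0 : ∏ q ∈ Fb j 0, colourWeight g h q (c q) = ∏ q ∈ Fb j 0, g j q * h j q / q :=
      Finset.prod_congr rfl fun q hq => by rw [(Finset.mem_filter.1 hq).2]; rfl
    have hw1 : ∏ q ∈ Fb j 1, colourWeight g h q (c q) = ∏ q ∈ Fb j 1, g j q / q :=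
      Finset.prod_congr rfl fun q hq => by rw [(Finset.mem_filter.1 hq).2]; rfl
    have hw2 : ∏ q ∈ Fb j 2, colourWeight g h q (c q) = ∏ q ∈ Fb j 2, h j q / q :=
      Finset.prod_congr rfl fun q hq => by
        rw [(Finset.mem_filter.1 hq).2]
        simp [colourWeight]
    rw [hw0, hw1, hw2, lcm_colourFst_colourSnd hP, colourFst, colourSnd, hpart, hpart, hpart,
      ← Finset.prod_union (hdisj j 0 1 (by decide)), ← Finset.prod_union (hdisj j 0 2 (by decide)),
      (hg j).map_prod_coe hP, (hh j).map_prod_coe hP, Finset.prod_union (hdisj j 0 1 (by decide)),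
      Finset.prod_union (hdisj j 0 2 (by decide))]
    push_cast
    rw [Finset.prod_union (hdisj j 0 1 (by decide)), Finset.prod_div_distrib, Finset.prod_div_distrib,
      Finset.prod_div_distrib, Finset.prod_mul_distrib]
    have h0 := hne (Fb j 0); have h1 := hne (Fb j 1); have h2 := hne (Fb j 2)
    field_simp
  -- assemble
  unfold pairSummand
  simp only
  rw [Finset.prod_congr rfl fun j _ => hj j]
  -- `∏_j ∏_{t} ∏_{fibre (j,t)}` as a product over all fibres
  have hfib : ∏ q : ↥P, colourWeight g h q (c q) =
      ∏ o : Colour ι, ∏ q ∈ Finset.univ.filter (fun q : ↥P => c q = o), colourWeight g h q (c q) :=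
    (Finset.prod_fiberwise Finset.univ c fun q => colourWeight g h q (c q)).symm
  rw [hfib, Fintype.prod_option, prod_filter_none, one_mul, Fintype.prod_prod_type]
  refine Finset.prod_congr rfl fun j _ => ?_
  rw [Fin.prod_univ_three]

/-- **The Euler product factorisation of (multisum)** (Polymath 8b, (euler-fac), p. 12): for weights
`g_j, h_j` multiplicative over products of distinct primes and a finite set of primes `P`,
`∑_{(d,d') : d_j, d'_j ∣ ∏P, [d_j,d'_j] pairwise coprime} ∏_j g_j(d_j) h_j(d'_j)/[d_j,d'_j]
   = ∏_{p ∈ P} (1 + (1/p) ∑_j (g_j(p) h_j(p) + g_j(p) + h_j(p)))`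
("`K = ∏_p K_p`, where `K_p = 1 + (1/p) ∑_{[d_1,…,d'_k] = p, [d_j,d'_j] coprime} ∏_j …`").
[cite: Polymath8b2014, Lemma 4.1 (proof, (euler-fac))] -/
theorem sum_pairBox_filter_eq_prod (g h : ι → ℕ → ℂ) (hg : ∀ j, IsPrimeProdMult (g j))
    (hh : ∀ j, IsPrimeProdMult (h j)) :
    ∑ t ∈ (pairBox ι P).filter PairwiseCoprimeLcm, pairSummand g h t =
      ∏ q ∈ P, (1 + ∑ j, (g j q * h j q + g j q + h j q) / q) := by
  have hprod0 : (∏ q ∈ P, q) ≠ 0 := Finset.prod_ne_zero_iff.2 fun q hq => (hP q hq).ne_zero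
  -- bijection with colourings
  have hbij : ∑ c : ↥P → Colour ι, pairSummand g h (colourFst P c, colourSnd P c) =
      ∑ t ∈ (pairBox ι P).filter PairwiseCoprimeLcm, pairSummand g h t := by
    refine Finset.sum_bij (fun c _ => (colourFst P c, colourSnd P c)) ?_ ?_ ?_ (fun _ _ => rfl)
    · intro c _
      simp only [Finset.mem_filter, pairBox, Finset.mem_product, Fintype.mem_piFinset,
        Nat.mem_divisors]
      exact ⟨⟨fun j => ⟨colourFst_dvd_prod hP c j, hprod0⟩, fun j => ⟨colourSnd_dvd_prod hP c j, hprod0⟩⟩,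
        fun i j hij => coprime_lcm_of_ne hP c hij⟩
    · intro c₁ _ c₂ _ heq
      simp only [Prod.mk.injEq] at heq
      exact colour_injective hP heq.1 heq.2
    · intro t ht
      simp only [Finset.mem_filter, pairBox, Finset.mem_product, Fintype.mem_piFinset,
        Nat.mem_divisors] at ht
      obtain ⟨⟨h1, h2⟩, hpw⟩ := ht
      refine ⟨colourOf (P := P) t, Finset.mem_univ _, ?_⟩
      ext j
      · exact colourFst_colourOf hP hpw (fun j => (h1 j).1) j
      · exact colourSnd_colourOf hP hpw (fun j => (h2 j).1) j
  rw [← hbij, Finset.sum_congr rfl fun c _ => pairSummand_colour hP g h hg hh c]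
  -- `∑_c ∏_q w(q, c q) = ∏_q ∑_o w(q, o)`
  have hps := Finset.prod_univ_sum (fun _ : ↥P => (Finset.univ : Finset (Colour ι)))
    (fun q o => colourWeight g h q o)
  rw [Fintype.piFinset_univ] at hps
  rw [← hps, ← Finset.prod_coe_sort P]
  refine Finset.prod_congr rfl fun q _ => ?_
  rw [Fintype.sum_option, Fintype.sum_prod_type]
  simp only [colourWeight, Fin.sum_univ_three, Fin.isValue]
  simp only [show (1 : Fin 3) = 0 ↔ False by decide, show (2 : Fin 3) = 0 ↔ False by decide,
    show (2 : Fin 3) = 1 ↔ False by decide, if_true, if_false]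
  congr 1
  refine Finset.sum_congr rfl fun j _ => ?_
  ring

end Euler

end LcmEuler

end Literature.NumberTheory.Sieve
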